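import Literature.Analysis.FluidPDE.NSUniqueness2DProofs
import Literature.Analysis.FluidPDE.NSHopfGalerkinExistence
import Literature.Analysis.FluidPDE.NSEnstrophyBalance2DGalerkin
import HarnessLib

/-!
# Galerkin trajectories against a Leray–Hopf solution on the flat torus: the identities behind
  the energy inequality for the difference

Analysis/FluidPDE support file (file 2 of the discharge of
`Literature.Analysis.FluidPDE.galerkin_tendsto_lerayHopf_torus2`, `NSEnstrophyBalance2DGalerkin`;
Foias–Manley–Rosa–Temam 2001, Ch. II Thm. 7.3). The discharge is Serrin's weak–strong energy
method with the Galerkin approximation `U(s) = realTrigPoly S (α s)‾` as the strong solution: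
`|u - U|² = |u|² + |U|² - 2(u, U)` is controlled by the energy inequality of `u`, the energy
identity of `U` and the cross identity (`NSGalerkinCrossIdentity`). This file supplies, in every
dimension and on the Fourier side, the identities that turn that sum into the energy inequality
of `w = u - U` (next file):

* `integral_inner_galerkinRHS_eq` — the Galerkin time derivative paired with an `L²` weakly
  divergence-free field `v`:
  `∫ ⟪v, ∂ₜU⟫ = -∫ ⟪P_S v, (U·∇)U⟫ + ν ∫ ⟪v, ΔU⟫ + ∫ ⟪P_S f, P_S v⟫`
  (the Galerkin equations tested with the `S`-truncation `P_S v = realTrigPoly S v̂`,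
  `Torus.sum_re_inner_galerkinField_test`; Robinson–Rodrigo–Sadowski 2016, (4.5));
* `toReal_eGradNormSq_sub_realTrigPoly` — polarisation of the spectral dissipation,
  `‖∇(v - U)‖₂² = ‖∇v‖₂² + ‖∇U‖₂² + 2∫⟪v, ΔU⟫` for `v ∈ L²` of finite dissipation;
* pairings through the truncation (`integral_inner_truncation_realTrigPoly_coeffExt`,
  `integral_inner_force_realTrigPoly_coeffExt`, `integral_inner_galerkinForce_truncation`,
  `integral_inner_sub_truncation_comm`), the truncation of the self-convection
  (`truncation_convect_galerkin_eq`), and the rearrangement of the two trilinear terms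
  (`inner_apply_sub_inner_apply_eq`: `⟪u, Lu⟫ - ⟪p, LU⟫ = ⟪U, L(u-U)⟫ + ⟪u-U, L(u-U)⟫ + ⟪u-p, LU⟫`,
  Foias–Manley–Rosa–Temam 2001, (A.44)–(A.45)).

## Mathlib / tree search

Parseval-type finite sums for real trigonometric polynomials (`TorusTrigPoly`,
`integral_inner_realTrigPoly_left/right`), the Galerkin dictionary (`NSGalerkinFourier`,
`NSHopfGalerkinExistence`), the trilinear antisymmetry and the self-adjoint Laplacian on smooth
fields (`TorusFluidGlueProofs`), `ENNReal.summable_toReal`, `ENNReal.ofReal_tsum_of_nonneg`,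
`norm_sub_sq` (Mathlib). Nothing of this kind for the pairing of a rough field with the Galerkin
vector field existed (searched `galerkinRHS`, `sum_re_inner_galerkinField` users).

## References

* J. C. Robinson, J. L. Rodrigo, W. Sadowski, *The three-dimensional Navier–Stokes equations*,
  CUP 2016, Thm. 4.4 (4.5), Lemma 8.18.
* C. Foias, O. Manley, R. Rosa, R. Temam, *Navier–Stokes Equations and Turbulence*, CUP 2001,
  Ch. II §7, Thm. 7.3; App. II.A (A.44)–(A.45).
* J. Serrin, *The initial value problem for the Navier–Stokes equations* (1963), §4.
-/

noncomputable section

open MeasureTheory TopologicalSpace Set Function Filter UnitAddTorus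
open scoped InnerProductSpace RealInnerProductSpace ENNReal NNReal Topology

namespace Literature.Analysis.FluidPDE

open FunctionSpaces.Torus Torus

/-! ### Pairings on the Fourier side -/
section Fourier

variable {d : Type*} [Fintype d] [DecidableEq d] {S : Finset (d → ℤ)} {ν : ℝ}

omit [DecidableEq d] in
/-- The `S`-truncation `realTrigPoly S v̂` of an `L²` field has the Fourier coefficients of `v`
on `S` and none outside. [folklore] -/
theorem mFourierCoeff_realTrigPoly_mFourierCoeff (hS : ∀ k ∈ S, -k ∈ S)
    {v : UnitAddTorus d → EuclideanSpace ℝ d} (hv : Integrable v volume) (k : d → ℤ) :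
    mFourierCoeff (FunctionSpaces.EuclideanSpace.complexify ∘
        realTrigPoly S (fun l => mFourierCoeff (FunctionSpaces.EuclideanSpace.complexify ∘ v) l)) k =
      if k ∈ S then mFourierCoeff (FunctionSpaces.EuclideanSpace.complexify ∘ v) k else 0 :=
  mFourierCoeff_realTrigPoly hS (isConjSymm_mFourierCoeff hv) k

omit [DecidableEq d] in
/-- Fourier coefficients of a Galerkin field `realTrigPoly S c̄`: the zero-extended coefficient
vector, at every frequency. [folklore] -/
theorem mFourierCoeff_realTrigPoly_coeffExt (hS : ∀ k ∈ S, -k ∈ S)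
    {c : ↥S → EuclideanSpace ℂ d} (hc : IsRealCoeff c) (k : d → ℤ) :
    mFourierCoeff (FunctionSpaces.EuclideanSpace.complexify ∘ realTrigPoly S (coeffExt S c)) k =
      coeffExt S c k := by
  rw [mFourierCoeff_realTrigPoly hS (hc.isConjSymm_coeffExt hS)]
  by_cases hk : k ∈ S
  · rw [if_pos hk]
  · rw [if_neg hk, coeffExt_of_not_mem _ hk]

omit [DecidableEq d] in
/-- **Pairing an `L²` field with a Galerkin field through the `S`-truncation**: for `w ∈ L²` and
a real coefficient vector `c`, `∫ ⟪realTrigPoly S ŵ, realTrigPoly S c̄⟫ = ∫ ⟪w, realTrigPoly S c̄⟫`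
(Parseval on both sides; only the modes in `S` contribute). [folklore] -/
theorem integral_inner_truncation_realTrigPoly_coeffExt (hS : ∀ k ∈ S, -k ∈ S)
    {w : UnitAddTorus d → EuclideanSpace ℝ d} (hw : MemLp w 2 volume)
    {c : ↥S → EuclideanSpace ℂ d} (hc : IsRealCoeff c) :
    ∫ x, ⟪realTrigPoly S (fun l => mFourierCoeff (FunctionSpaces.EuclideanSpace.complexify ∘ w) l) x,
        realTrigPoly S (coeffExt S c) x⟫ =
      ∫ x, ⟪w x, realTrigPoly S (coeffExt S c) x⟫ := by
  have hwi : Integrable w volume := hw.integrable one_le_two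
  rw [integral_inner_realTrigPoly_right hS (hc.isConjSymm_coeffExt hS) (memLp_realTrigPoly S _ 2),
    integral_inner_realTrigPoly_right hS (hc.isConjSymm_coeffExt hS) hw]
  refine Finset.sum_congr rfl fun k hk => ?_
  rw [mFourierCoeff_realTrigPoly_mFourierCoeff hS hwi, if_pos hk]

omit [DecidableEq d] in
/-- **Pairing a Galerkin field with an `L²` field through the `S`-truncation**:
`∫ ⟪realTrigPoly S c̄, realTrigPoly S ŵ⟫ = ∫ ⟪realTrigPoly S c̄, w⟫`. [folklore] -/
theorem integral_inner_realTrigPoly_coeffExt_truncation (hS : ∀ k ∈ S, -k ∈ S)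
    {w : UnitAddTorus d → EuclideanSpace ℝ d} (hw : MemLp w 2 volume)
    {c : ↥S → EuclideanSpace ℂ d} (hc : IsRealCoeff c) :
    ∫ x, ⟪realTrigPoly S (coeffExt S c) x,
        realTrigPoly S (fun l => mFourierCoeff (FunctionSpaces.EuclideanSpace.complexify ∘ w) l) x⟫ =
      ∫ x, ⟪realTrigPoly S (coeffExt S c) x, w x⟫ := by
  have h := integral_inner_truncation_realTrigPoly_coeffExt hS hw hc
  rw [show (fun x => ⟪realTrigPoly S (coeffExt S c) x,
      realTrigPoly S (fun l => mFourierCoeff (FunctionSpaces.EuclideanSpace.complexify ∘ w) l) x⟫) =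
      fun x => ⟪realTrigPoly S (fun l => mFourierCoeff (FunctionSpaces.EuclideanSpace.complexify ∘ w) l) x,
        realTrigPoly S (coeffExt S c) x⟫ from funext fun x => real_inner_comm _ _, h]
  exact integral_congr_ae (ae_of_all _ fun x => real_inner_comm _ _)

omit [DecidableEq d] in
/-- The force paired with a Galerkin field: `∫ ⟪f, realTrigPoly S c̄⟫ = ∫ ⟪realTrigPoly S f̂|_S, realTrigPoly S c̄⟫`
(the Galerkin force `P_S f` and `f` agree against band-limited fields). [folklore] -/
theorem integral_inner_force_realTrigPoly_coeffExt (hS : ∀ k ∈ S, -k ∈ S)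
    {f : UnitAddTorus d → EuclideanSpace ℝ d} (hf : MemLp f 2 volume)
    {c : ↥S → EuclideanSpace ℂ d} (hc : IsRealCoeff c) :
    ∫ x, ⟪f x, realTrigPoly S (coeffExt S c) x⟫ =
      ∫ x, ⟪realTrigPoly S (coeffExt S (fourierRestrict S f)) x, realTrigPoly S (coeffExt S c) x⟫ := by
  have hfr : realTrigPoly S (coeffExt S (fourierRestrict S f)) =
      realTrigPoly S (fun l => mFourierCoeff (FunctionSpaces.EuclideanSpace.complexify ∘ f) l) :=
    realTrigPoly_congr fun k hk => by rw [coeffExt_of_mem _ hk, fourierRestrict_apply]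
  rw [hfr, integral_inner_truncation_realTrigPoly_coeffExt hS hf hc]

omit [DecidableEq d] in
/-- The Galerkin force paired with the `S`-truncation of an `L²` field:
`∫ ⟪realTrigPoly S f̂|_S, realTrigPoly S ŵ⟫ = ∫ ⟪realTrigPoly S f̂|_S, w⟫`. [folklore] -/
theorem integral_inner_galerkinForce_truncation (hS : ∀ k ∈ S, -k ∈ S)
    {f : UnitAddTorus d → EuclideanSpace ℝ d} (hf : Integrable f volume)
    {w : UnitAddTorus d → EuclideanSpace ℝ d} (hw : MemLp w 2 volume) :
    ∫ x, ⟪realTrigPoly S (coeffExt S (fourierRestrict S f)) x,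
        realTrigPoly S (fun l => mFourierCoeff (FunctionSpaces.EuclideanSpace.complexify ∘ w) l) x⟫ =
      ∫ x, ⟪realTrigPoly S (coeffExt S (fourierRestrict S f)) x, w x⟫ :=
  integral_inner_realTrigPoly_coeffExt_truncation hS hw (isRealCoeff_mFourierCoeff hf)

/-- **The Galerkin time derivative paired with an `L²` field.** Let `S` be symmetric, `c` in the
Galerkin phase space, `g` real force coefficients, `v ∈ L²` weakly divergence free; write
`V = realTrigPoly S c̄`, `G = realTrigPoly S ḡ`, `P_S v = realTrigPoly S v̂`. Then
`∫ ⟪v, realTrigPoly S (galerkinRHS S ν g c)‾⟫ = -∫ ⟪P_S v, (V·∇)V⟫ + ν ∫ ⟪v, ΔV⟫ + ∫ ⟪G, P_S v⟫`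
(the Galerkin equations tested with `P_S v`, `NS`-master identity
`Torus.sum_re_inner_galerkinField_test`, then antisymmetry of the trilinear form and
self-adjointness of the Laplacian on the band-limited fields; Robinson–Rodrigo–Sadowski 2016,
(4.5)). [cite: RobinsonRodrigoSadowski2016, Thm. 4.4 Step 1 (4.5)] -/
theorem integral_inner_galerkinRHS_eq (hS : ∀ k ∈ S, -k ∈ S) {c g : ↥S → EuclideanSpace ℂ d}
    (hc : c ∈ galerkinSubspace S) (hg : IsRealCoeff g)
    {v : UnitAddTorus d → EuclideanSpace ℝ d} (hv : MemLp v 2 volume)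
    (hdiv : FunctionSpaces.Torus.IsWeaklyDivFree v) :
    ∫ x, ⟪v x, realTrigPoly S (coeffExt S (galerkinRHS S ν g c)) x⟫ =
      -(∫ x, ⟪realTrigPoly S (fun l => mFourierCoeff (FunctionSpaces.EuclideanSpace.complexify ∘ v) l) x,
          FunctionSpaces.Torus.convect (realTrigPoly S (coeffExt S c)) (realTrigPoly S (coeffExt S c)) x⟫) +
        ν * (∫ x, ⟪v x, FunctionSpaces.Torus.laplacian (realTrigPoly S (coeffExt S c)) x⟫) +
        ∫ x, ⟪realTrigPoly S (coeffExt S g) x,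
          realTrigPoly S (fun l => mFourierCoeff (FunctionSpaces.EuclideanSpace.complexify ∘ v) l) x⟫ := by
  have hvi : Integrable v volume := hv.integrable one_le_two
  set a : UnitAddTorus d → EuclideanSpace ℝ d :=
    realTrigPoly S (fun l => mFourierCoeff (FunctionSpaces.EuclideanSpace.complexify ∘ v) l) with ha_def
  set V : UnitAddTorus d → EuclideanSpace ℝ d := realTrigPoly S (coeffExt S c) with hV_def
  have ha : FunctionSpaces.Torus.IsSmooth a := isSmooth_realTrigPoly S _
  have hadiv : FunctionSpaces.Torus.IsDivFree a :=
    isDivFree_realTrigPoly (hdiv.isTransversal_mFourierCoeff hv S)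
  have haconj : IsConjSymm fun l => mFourierCoeff (FunctionSpaces.EuclideanSpace.complexify ∘ v) l :=
    isConjSymm_mFourierCoeff hvi
  have hband : ∀ k ∉ S, mFourierCoeff (FunctionSpaces.EuclideanSpace.complexify ∘ a) k = 0 :=
    fun k hk => mFourierCoeff_realTrigPoly_eq_zero hS haconj hk
  have hcoefS : ∀ k ∈ S, mFourierCoeff (FunctionSpaces.EuclideanSpace.complexify ∘ a) k =
      mFourierCoeff (FunctionSpaces.EuclideanSpace.complexify ∘ v) k := fun k hk => by
    rw [ha_def, mFourierCoeff_realTrigPoly hS haconj, if_pos hk]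
  have hV : FunctionSpaces.Torus.IsSmooth V := isSmooth_realTrigPoly S _
  have hVdiv : FunctionSpaces.Torus.IsDivFree V := isDivFree_realTrigPoly hc.2.isTransversal_coeffExt
  have hRconj : IsConjSymm (coeffExt S (galerkinRHS S ν g c)) :=
    (galerkinRHS_mem ν hS hg hc).1.isConjSymm_coeffExt hS
  -- the left-hand side on the Fourier side
  have hL : ∫ x, ⟪v x, realTrigPoly S (coeffExt S (galerkinRHS S ν g c)) x⟫ =
      ∑ k ∈ S, (inner ℂ (galerkinField ν S (coeffExt S g) (coeffExt S c) k)
        (mFourierCoeff (FunctionSpaces.EuclideanSpace.complexify ∘ a) k)).re := by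
    rw [integral_inner_realTrigPoly_right hS hRconj hv]
    refine Finset.sum_congr rfl fun k hk => ?_
    rw [coeffExt_of_mem _ hk, galerkinRHS_apply, hcoefS k hk]
    exact (inner_re_symm (𝕜 := ℂ) _ _)
  rw [hL, sum_re_inner_galerkinField_test ν hS (hg.isConjSymm_coeffExt hS)
    (hc.1.isConjSymm_coeffExt hS) hc.2.isTransversal_coeffExt ha hadiv hband]
  -- split and transform the three terms
  have hi1 : Integrable (fun x => ⟪V x, FunctionSpaces.Torus.convect V a x⟫) volume :=
    (hV.inner (hV.convect ha)).integrable
  have hi2 : Integrable (fun x => ν * ⟪V x, FunctionSpaces.Torus.laplacian a x⟫) volume :=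
    ((hV.inner ha.laplacian).integrable).const_mul ν
  have hi3 : Integrable (fun x => ⟪realTrigPoly S (coeffExt S g) x, a x⟫) volume :=
    ((isSmooth_realTrigPoly S _).inner ha).integrable
  have hi12 : Integrable (fun x => ⟪V x, FunctionSpaces.Torus.convect V a x⟫ +
      ν * ⟪V x, FunctionSpaces.Torus.laplacian a x⟫) volume := hi1.add hi2
  rw [← hV_def, integral_add hi12 hi3, integral_add hi1 hi2, integral_const_mul]
  -- antisymmetry of the trilinear form
  have hanti : ∫ x, ⟪V x, FunctionSpaces.Torus.convect V a x⟫ =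
      -∫ x, ⟪a x, FunctionSpaces.Torus.convect V V x⟫ := by
    rw [← integral_inner_convect_eq_neg hV hVdiv ha hV]
    exact integral_congr_ae (ae_of_all _ fun x => real_inner_comm _ _)
  -- the Laplacian term: self-adjointness and Parseval on `S`
  have hlap : ∫ x, ⟪V x, FunctionSpaces.Torus.laplacian a x⟫ =
      ∫ x, ⟪v x, FunctionSpaces.Torus.laplacian V x⟫ := by
    have h1 : ∫ x, ⟪V x, FunctionSpaces.Torus.laplacian a x⟫ = ∫ x, ⟪a x, FunctionSpaces.Torus.laplacian V x⟫ := by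
      rw [← FunctionSpaces.Torus.integral_inner_laplacian_comm hV ha]
      exact integral_congr_ae (ae_of_all _ fun x => real_inner_comm _ _)
    set L : (d → ℤ) → EuclideanSpace ℂ d := fun k =>
      -(((4 * Real.pi ^ 2 * freqNormSq k : ℝ) : ℂ) • coeffExt S c k) with hL_def
    have hLconj : IsConjSymm L := isConjSymm_laplacianCoeff (hc.1.isConjSymm_coeffExt hS)
    have hlapV : FunctionSpaces.Torus.laplacian V = realTrigPoly S L := funext fun x => laplacian_realTrigPoly S _ x
    rw [h1, hlapV, integral_inner_realTrigPoly_right hS hLconj (memLp_realTrigPoly S _ 2),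
      integral_inner_realTrigPoly_right hS hLconj hv]
    refine Finset.sum_congr rfl fun k hk => ?_
    rw [hcoefS k hk]
  rw [hanti, hlap]

end Fourier

/-! ### The dissipation of the difference -/
section Dissipation

variable {d : Type*} [Fintype d] [DecidableEq d] {S : Finset (d → ℤ)}


omit [DecidableEq d] in
/-- The spectral dissipation of an `L²` field with finite dissipation as a real series:
`(eGradNormSq v).toReal = 4π² ∑ₖ |k|² ‖v̂(k)‖²`, the series being summable. [folklore] -/
theorem hasSum_toReal_eGradNormSq {v : UnitAddTorus d → EuclideanSpace ℝ d}
    (hfin : eGradNormSq v ≠ ⊤) :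
    HasSum (fun k : d → ℤ => 4 * Real.pi ^ 2 * (freqNormSq k *
      ‖mFourierCoeff (FunctionSpaces.EuclideanSpace.complexify ∘ v) k‖ ^ 2)) (eGradNormSq v).toReal := by
  have hterm : ∀ k : d → ℤ, ENNReal.ofReal (freqNormSq k) *
      ‖mFourierCoeff (FunctionSpaces.EuclideanSpace.complexify ∘ v) k‖ₑ ^ 2 =
      ENNReal.ofReal (freqNormSq k * ‖mFourierCoeff (FunctionSpaces.EuclideanSpace.complexify ∘ v) k‖ ^ 2) :=
    fun k => by
    rw [← ofReal_norm, ← ENNReal.ofReal_pow (norm_nonneg _), ENNReal.ofReal_mul (freqNormSq_nonneg k)]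
  have heq : eGradNormSq v = ENNReal.ofReal (4 * Real.pi ^ 2) *
      ∑' k : d → ℤ, ENNReal.ofReal (freqNormSq k *
        ‖mFourierCoeff (FunctionSpaces.EuclideanSpace.complexify ∘ v) k‖ ^ 2) := by
    rw [eGradNormSq_eq_tsum]
    exact congrArg _ (tsum_congr hterm)
  have hT : ∑' k : d → ℤ, ENNReal.ofReal (freqNormSq k *
      ‖mFourierCoeff (FunctionSpaces.EuclideanSpace.complexify ∘ v) k‖ ^ 2) ≠ ⊤ := by
    intro h
    rw [heq, h, ENNReal.mul_top (by positivity)] at hfin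
    exact hfin rfl
  have hsum : Summable fun k : d → ℤ => freqNormSq k *
      ‖mFourierCoeff (FunctionSpaces.EuclideanSpace.complexify ∘ v) k‖ ^ 2 := by
    have h := ENNReal.summable_toReal hT
    simpa only [ENNReal.toReal_ofReal (mul_nonneg (freqNormSq_nonneg _) (sq_nonneg _))] using h
  have htsum : (eGradNormSq v).toReal = 4 * Real.pi ^ 2 * ∑' k : d → ℤ, freqNormSq k *
      ‖mFourierCoeff (FunctionSpaces.EuclideanSpace.complexify ∘ v) k‖ ^ 2 := by
    rw [heq, ENNReal.toReal_mul, ENNReal.toReal_ofReal (by positivity),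
      ENNReal.tsum_toReal_eq fun k => ENNReal.ofReal_ne_top]
    simp_rw [ENNReal.toReal_ofReal (mul_nonneg (freqNormSq_nonneg _) (sq_nonneg _))]
  rw [htsum]
  exact hsum.hasSum.mul_left _

/-- **The dissipation of the difference of an `L²` field and a Galerkin field**: for `v ∈ L²`
with `eGradNormSq v < ∞` and a real coefficient vector `c` on a symmetric `S`,
`‖∇(v - V)‖₂² = ‖∇v‖₂² + ‖∇V‖₂² + 2 ∫ ⟪v, ΔV⟫`, `V = realTrigPoly S c̄`
(polarisation on the Fourier side, `‖a - b‖² = ‖a‖² + ‖b‖² - 2 Re⟪a, b⟫` termwise, and Parseval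
for the band-limited `ΔV`; all three dissipations as real numbers). [folklore] -/
theorem toReal_eGradNormSq_sub_realTrigPoly (hS : ∀ k ∈ S, -k ∈ S)
    {v : UnitAddTorus d → EuclideanSpace ℝ d} (hv : MemLp v 2 volume) (hfin : eGradNormSq v ≠ ⊤)
    {c : ↥S → EuclideanSpace ℂ d} (hc : IsRealCoeff c) :
    (eGradNormSq (v - realTrigPoly S (coeffExt S c))).toReal =
      (eGradNormSq v).toReal + (eGradNormSq (realTrigPoly S (coeffExt S c))).toReal +
        2 * ∫ x, ⟪v x, FunctionSpaces.Torus.laplacian (realTrigPoly S (coeffExt S c)) x⟫ := by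
  have hvi : Integrable v volume := hv.integrable one_le_two
  set V : UnitAddTorus d → EuclideanSpace ℝ d := realTrigPoly S (coeffExt S c) with hV_def
  have hVi : Integrable V volume := (isSmooth_realTrigPoly S _).integrable
  set a : (d → ℤ) → EuclideanSpace ℂ d := fun k =>
    mFourierCoeff (FunctionSpaces.EuclideanSpace.complexify ∘ v) k with ha
  set b : (d → ℤ) → EuclideanSpace ℂ d := coeffExt S c with hb
  have hVcoef : ∀ k, mFourierCoeff (FunctionSpaces.EuclideanSpace.complexify ∘ V) k = b k :=
    fun k => mFourierCoeff_realTrigPoly_coeffExt hS hc k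
  have hsub : ∀ k, mFourierCoeff (FunctionSpaces.EuclideanSpace.complexify ∘ (v - V)) k = a k - b k := by
    intro k
    rw [Torus.mFourierCoeff_complexify_sub hvi hVi, hVcoef]
  have hb0 : ∀ k ∉ S, b k = 0 := fun k hk => coeffExt_of_not_mem _ hk
  -- the series for `v`
  have hHv := hasSum_toReal_eGradNormSq hfin
  -- the finitely supported correction
  set e : (d → ℤ) → ℝ := fun k => 4 * Real.pi ^ 2 * (freqNormSq k *
    (‖b k‖ ^ 2 - 2 * (inner ℂ (a k) (b k)).re)) with he
  have he0 : ∀ k ∉ S, e k = 0 := fun k hk => by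
    simp only [he, hb0 k hk, norm_zero, inner_zero_right, Complex.zero_re]
    ring
  have hHe : HasSum e (∑ k ∈ S, e k) := hasSum_sum_of_ne_finset_zero he0
  -- termwise polarisation
  have hpol : ∀ k, 4 * Real.pi ^ 2 * (freqNormSq k * ‖a k - b k‖ ^ 2) =
      4 * Real.pi ^ 2 * (freqNormSq k * ‖a k‖ ^ 2) + e k := by
    intro k
    rw [he, @norm_sub_sq ℂ]
    simp only [RCLike.re_to_complex]
    ring
  have hHsub : HasSum (fun k : d → ℤ => 4 * Real.pi ^ 2 * (freqNormSq k * ‖a k - b k‖ ^ 2))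
      ((eGradNormSq v).toReal + ∑ k ∈ S, e k) := by
    simp_rw [hpol]
    exact hHv.add hHe
  -- the dissipation of `v - V` as the sum of that series
  have hfin' : eGradNormSq (v - V) ≠ ⊤ := by
    have hnn : ∀ k, 0 ≤ 4 * Real.pi ^ 2 * (freqNormSq k * ‖a k - b k‖ ^ 2) := fun k => by
      have := freqNormSq_nonneg k; positivity
    rw [eGradNormSq_eq_tsum]
    simp_rw [hsub]
    have hterm : ∀ k : d → ℤ, ENNReal.ofReal (4 * Real.pi ^ 2) *
        (ENNReal.ofReal (freqNormSq k) * ‖a k - b k‖ₑ ^ 2) =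
        ENNReal.ofReal (4 * Real.pi ^ 2 * (freqNormSq k * ‖a k - b k‖ ^ 2)) := fun k => by
      rw [← ofReal_norm, ← ENNReal.ofReal_pow (norm_nonneg _),
        ← ENNReal.ofReal_mul (freqNormSq_nonneg k), ← ENNReal.ofReal_mul (by positivity)]
    rw [← ENNReal.tsum_mul_left]
    simp_rw [hterm]
    rw [← ENNReal.ofReal_tsum_of_nonneg hnn hHsub.summable]
    exact ENNReal.ofReal_ne_top
  have hHsub' := hasSum_toReal_eGradNormSq hfin'
  simp_rw [hsub] at hHsub'
  have hE : (eGradNormSq (v - V)).toReal = (eGradNormSq v).toReal + ∑ k ∈ S, e k :=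
    hHsub'.unique hHsub
  -- identify the correction
  have hEV : (eGradNormSq V).toReal = 4 * Real.pi ^ 2 * ∑ k ∈ S, freqNormSq k * ‖b k‖ ^ 2 := by
    rw [hV_def, toReal_eGradNormSq_realTrigPoly hS (hc.isConjSymm_coeffExt hS)]
  have hlap : ∫ x, ⟪v x, FunctionSpaces.Torus.laplacian V x⟫ =
      -(4 * Real.pi ^ 2) * ∑ k ∈ S, freqNormSq k * (inner ℂ (a k) (b k)).re := by
    set L : (d → ℤ) → EuclideanSpace ℂ d := fun k =>
      -(((4 * Real.pi ^ 2 * freqNormSq k : ℝ) : ℂ) • b k) with hL_def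
    have hLconj : IsConjSymm L := isConjSymm_laplacianCoeff (hc.isConjSymm_coeffExt hS)
    have hlapV : FunctionSpaces.Torus.laplacian V = realTrigPoly S L :=
      funext fun x => laplacian_realTrigPoly S _ x
    rw [hlapV, integral_inner_realTrigPoly_right hS hLconj hv, Finset.mul_sum]
    refine Finset.sum_congr rfl fun k _ => ?_
    rw [hL_def]
    dsimp only
    rw [inner_neg_right, inner_smul_right, Complex.neg_re, Complex.re_ofReal_mul]
    ring
  have hsumE : ∑ k ∈ S, e k = 4 * Real.pi ^ 2 * (∑ k ∈ S, freqNormSq k * ‖b k‖ ^ 2) +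
      2 * (-(4 * Real.pi ^ 2) * ∑ k ∈ S, freqNormSq k * (inner ℂ (a k) (b k)).re) := by
    rw [Finset.mul_sum, Finset.mul_sum, Finset.mul_sum, ← Finset.sum_add_distrib]
    refine Finset.sum_congr rfl fun k _ => ?_
    rw [he]
    ring
  rw [hE, hEV, hlap, hsumE]
  ring

end Dissipation

/-! ### The trilinear terms: rearrangement and truncation -/

section Trilinear

variable {d : Type*} [Fintype d] [DecidableEq d] {S : Finset (d → ℤ)}

omit [Fintype d] [DecidableEq d] in
/-- **Rearrangement of the two trilinear terms** (pure linear algebra): for a real-linear `L`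
(the derivative `DU(x)`) and vectors `u`, `U = U(x)`, `p = (P_S u)(x)`,
`⟪u, L u⟫ - ⟪p, L U⟫ = ⟪U, L(u - U)⟫ + ⟪u - U, L(u - U)⟫ + ⟪u - p, L U⟫`. [folklore] -/
theorem inner_apply_sub_inner_apply_eq {V : Type*} [NormedAddCommGroup V] [InnerProductSpace ℝ V]
    (L : V →L[ℝ] V) (u U p : V) :
    ⟪u, L u⟫ - ⟪p, L U⟫ = ⟪U, L (u - U)⟫ + ⟪u - U, L (u - U)⟫ + ⟪u - p, L U⟫ := by
  simp only [map_sub, inner_sub_left, inner_sub_right]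
  ring

/-- **The `S`-truncation of the self-convection of a Galerkin field is a real trigonometric
polynomial with the convection symbol as coefficients**:
`P_S((V·∇)V) = realTrigPoly S (convectionCoeff S c̄ c̄)` for `V = realTrigPoly S c̄`, `c` real. [folklore] -/
theorem truncation_convect_galerkin_eq (hS : ∀ k ∈ S, -k ∈ S) {c : ↥S → EuclideanSpace ℂ d}
    (hc : IsRealCoeff c) :
    realTrigPoly S (fun l => mFourierCoeff (FunctionSpaces.EuclideanSpace.complexify ∘
        FunctionSpaces.Torus.convect (realTrigPoly S (coeffExt S c)) (realTrigPoly S (coeffExt S c))) l) =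
      realTrigPoly S (convectionCoeff S (coeffExt S c) (coeffExt S c)) :=
  realTrigPoly_congr fun k _ =>
    mFourierCoeff_convect_realTrigPoly hS (hc.isConjSymm_coeffExt hS) (hc.isConjSymm_coeffExt hS) k

omit [DecidableEq d] in
/-- **Moving the truncation across the pairing**: for `u, g ∈ L²` and a symmetric `S`,
`∫ ⟪u - P_S u, g⟫ = ∫ ⟪u, g - P_S g⟫` (`P_S` is symmetric: both cross terms equal
`∑_{k∈S} Re ⟪û(k), ĝ(k)⟫`). [folklore] -/
theorem integral_inner_sub_truncation_comm (hS : ∀ k ∈ S, -k ∈ S)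
    {u g : UnitAddTorus d → EuclideanSpace ℝ d} (hu : MemLp u 2 volume) (hg : FunctionSpaces.Torus.IsSmooth g) :
    ∫ x, ⟪u x - realTrigPoly S (fun l => mFourierCoeff (FunctionSpaces.EuclideanSpace.complexify ∘ u) l) x, g x⟫ =
      ∫ x, ⟪u x, g x - realTrigPoly S (fun l => mFourierCoeff (FunctionSpaces.EuclideanSpace.complexify ∘ g) l) x⟫ := by
  have hui : Integrable u volume := hu.integrable one_le_two
  have hgi : Integrable g volume := hg.integrable
  have i1 : Integrable (fun x => ⟪u x, g x⟫) volume := integrable_inner_of_continuous hui hg.continuous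
  have i2 : Integrable (fun x => ⟪realTrigPoly S
      (fun l => mFourierCoeff (FunctionSpaces.EuclideanSpace.complexify ∘ u) l) x, g x⟫) volume := by
    have h := integrable_inner_of_continuous hgi (continuous_realTrigPoly S
      (fun l => mFourierCoeff (FunctionSpaces.EuclideanSpace.complexify ∘ u) l))
    exact h.congr (ae_of_all _ fun x => real_inner_comm _ _)
  have i3 : Integrable (fun x => ⟪u x, realTrigPoly S
      (fun l => mFourierCoeff (FunctionSpaces.EuclideanSpace.complexify ∘ g) l) x⟫) volume :=
    integrable_inner_of_continuous hui (continuous_realTrigPoly S _)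
  simp_rw [inner_sub_left, inner_sub_right]
  rw [integral_sub i1 i2, integral_sub i1 i3,
    integral_inner_realTrigPoly_left hS (isConjSymm_mFourierCoeff hui) (hg.memLp 2),
    integral_inner_realTrigPoly_right hS (isConjSymm_mFourierCoeff hgi) hu]

end Trilinear

end Literature.Analysis.FluidPDE
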